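import Summits.MatrixMultiplication.MatrixMultiplication.Theorems.SoloBlindSumsetRankBound
import Summits.MatrixMultiplication.MatrixMultiplication.Theorems.SoloBlindDegenerationRealization
import HarnessLib

/-!
# Toric degenerations of abelian realizations bound `bR(T_{cw,2}^{⊠N})` by the sumset

The degeneration rung `algBorderRank_kroneckerPow_cwTensor_le_card_of_degeneration`
(`SoloBlindDegenerationRealization`): maps `s : (Fin N → Fin 3) → H` into a finite abelian group,
`u : H`, weights `ω` and an order `h` such that the support triples of `T_xyz^{⊠N}` are exactly the
weight-`h` solutions of `s a + s b + s c = u` and all other solutions are heavier, give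
`bR(T_{cw,2}^{⊠N}) ≤ |H|`.  Combining the monomial-degeneration lemma
(`algBorderRank_initialPart_le_tensorRank`) with the **sumset bound**
`R([s a + s b + s c = u]) ≤ |s(A) + s(A)|` (`tensorRank_indicator₃_le_card_sumset`,
`SoloBlindSumsetRankBound`: characters + slice spans) sharpens the conclusion to

**Theorem** (`algBorderRank_kroneckerPow_cwTensor_le_card_sumset_of_degeneration`).
`bR(T_{cw,2}^{⊠N}) ≤ |s(A) + s(A)|`, the size of the sumset of the image of `s`.

So a toric (weighted) abelian degeneration datum at level `N` certifies an asymptotic-rank bound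
`R̃(T_{cw,2}) ≤ |s(A)+s(A)|^{1/N}`; any datum with `|s(A)+s(A)| < 4^N` — in a group of any order —
would be an explicit improvement of `R̃(T_{cw,2}) ≤ 4` (the value `3` gives `ω = 2`, Coppersmith–Winograd
1990 §11; the non-explicit record is `R̃(T_{cw,2}) < 3.931`, arXiv:2605.21738 Cor. 7.1, whose
Theorem 6.2 taken at `n = 3` even yields `R̃(T_{cw,2}) ≤ 60.394^{1/3} < 3.9235`).
(Computation, not formalised: for `N = 3` no separable datum with sumset `≤ 63` exists in any abelian
group of order `≤ 100`.)

## References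
* P. Bürgisser, M. Clausen, M. A. Shokrollahi, *Algebraic Complexity Theory*, Springer 1997, §15.5.
* D. Coppersmith, S. Winograd, J. Symb. Comput. 9 (1990), §11.
* "Asymptotic Rank Speedup Theorems, Revisited", arXiv:2605.21738 (2026), §5, §7.
-/

noncomputable section

open scoped BigOperators

open Literature.Computability.AlgebraicComplexity

set_option linter.dupNamespace false

namespace Summit.MatrixMultiplication.MatrixMultiplication.Theorems

set_option quotPrecheck false in
local notation "xyzT" =>
  (fun a b c : Fin 3 => if a ≠ b ∧ b ≠ c ∧ a ≠ c then (1 : ℂ) else 0)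

/-- **Sumset form of the degeneration rung.** A toric degeneration of an abelian realization of
`supp T_xyz^{⊠N}` (support triples = the weight-`h` solutions of `s a + s b + s c = u`, all other
solutions heavier) gives `bR(T_{cw,2}^{⊠N}) ≤ |s(A) + s(A)|`. [new] -/
theorem algBorderRank_kroneckerPow_cwTensor_le_card_sumset_of_degeneration {N : ℕ} {H : Type*}
    [AddCommGroup H] [Fintype H] [DecidableEq H] (s : (Fin N → Fin 3) → H) (u : H)
    (ω : (Fin N → Fin 3) → ℕ) (h : ℕ)
    (hsupp : ∀ a b c : Fin N → Fin 3, (∀ i, a i ≠ b i ∧ b i ≠ c i ∧ a i ≠ c i) →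
      s a + s b + s c = u ∧ ω a + ω b + ω c = h)
    (hcut : ∀ a b c : Fin N → Fin 3, s a + s b + s c = u →
      ¬ (∀ i, a i ≠ b i ∧ b i ≠ c i ∧ a i ≠ c i) → h < ω a + ω b + ω c) :
    algBorderRank (kroneckerPow (cwTensor ℂ 2) N) ≤ (sumset₂ s s).card := by
  have h1 : algBorderRank (kroneckerPow (cwTensor ℂ 2) N) ≤ algBorderRank (kroneckerPow xyzT N) :=
    ((xyzTensor_restrictsTo_cwTensor).kroneckerPow N).algBorderRank_le
  have h2 : kroneckerPow xyzT N = fun a b c => if ω a + ω b + ω c = h then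
      (if s a + s b + s c = u then (1 : ℂ) else 0) else 0 := by
    funext a b c
    rw [kroneckerPow_apply]
    by_cases hall : ∀ i, a i ≠ b i ∧ b i ≠ c i ∧ a i ≠ c i
    · obtain ⟨hs, hw⟩ := hsupp a b c hall
      rw [if_pos hw, if_pos hs]
      exact Finset.prod_eq_one fun i _ => by simp [hall i]
    · have lhs0 : (∏ i, xyzT (a i) (b i) (c i)) = 0 := by
        obtain ⟨i, hi⟩ := not_forall.mp hall
        exact Finset.prod_eq_zero (Finset.mem_univ i) (if_neg hi)
      rw [lhs0]
      by_cases hs : s a + s b + s c = u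
      · have := hcut a b c hs hall
        rw [if_neg (by omega)]
      · rw [if_neg hs]
        simp
  rw [h2] at h1
  refine h1.trans ((algBorderRank_initialPart_le_tensorRank
    (fun a b c : Fin N → Fin 3 => if s a + s b + s c = u then (1 : ℂ) else 0) ω ω ω h ?_).trans
    (tensorRank_indicator₃_le_card_sumset s s s u))
  intro a b c hlt
  by_cases hs : s a + s b + s c = u
  · exfalso
    by_cases hall : ∀ i, a i ≠ b i ∧ b i ≠ c i ∧ a i ≠ c i
    · have := (hsupp a b c hall).2
      omega
    · have := hcut a b c hs hall
      omega
  · exact if_neg hs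

/-- The same for the tree's inline form of `T_{cw,2}^{⊠N}` (`cwTwoPow_inline_eq`). [new] -/
theorem algBorderRank_cwTwoPow_le_card_sumset_of_degeneration {N : ℕ} {H : Type*}
    [AddCommGroup H] [Fintype H] [DecidableEq H] (s : (Fin N → Fin 3) → H) (u : H)
    (ω : (Fin N → Fin 3) → ℕ) (h : ℕ)
    (hsupp : ∀ a b c : Fin N → Fin 3, (∀ i, a i ≠ b i ∧ b i ≠ c i ∧ a i ≠ c i) →
      s a + s b + s c = u ∧ ω a + ω b + ω c = h)
    (hcut : ∀ a b c : Fin N → Fin 3, s a + s b + s c = u →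
      ¬ (∀ i, a i ≠ b i ∧ b i ≠ c i ∧ a i ≠ c i) → h < ω a + ω b + ω c) :
    algBorderRank (K := ℂ) (fun a b c : Fin N → Fin 3 => ∏ i,
        (if (a i = 0 ∧ b i = c i ∧ b i ≠ 0) ∨ (b i = 0 ∧ a i = c i ∧ a i ≠ 0) ∨
          (c i = 0 ∧ a i = b i ∧ a i ≠ 0) then (1 : ℂ) else 0)) ≤ (sumset₂ s s).card := by
  rw [cwTwoPow_inline_eq]
  exact algBorderRank_kroneckerPow_cwTensor_le_card_sumset_of_degeneration s u ω h hsupp hcut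

/-- In particular the sumset form implies the cardinality form, since `|s(A)+s(A)| ≤ |H|`. -/
theorem algBorderRank_kroneckerPow_cwTensor_le_card_of_degeneration' {N : ℕ} {H : Type*}
    [AddCommGroup H] [Fintype H] [DecidableEq H] (s : (Fin N → Fin 3) → H) (u : H)
    (ω : (Fin N → Fin 3) → ℕ) (h : ℕ)
    (hsupp : ∀ a b c : Fin N → Fin 3, (∀ i, a i ≠ b i ∧ b i ≠ c i ∧ a i ≠ c i) →
      s a + s b + s c = u ∧ ω a + ω b + ω c = h)
    (hcut : ∀ a b c : Fin N → Fin 3, s a + s b + s c = u →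
      ¬ (∀ i, a i ≠ b i ∧ b i ≠ c i ∧ a i ≠ c i) → h < ω a + ω b + ω c) :
    algBorderRank (kroneckerPow (cwTensor ℂ 2) N) ≤ (sumset₂ s s).card ∧
      (sumset₂ s s).card ≤ Fintype.card H :=
  ⟨algBorderRank_kroneckerPow_cwTensor_le_card_sumset_of_degeneration s u ω h hsupp hcut,
    card_sumset₂_le_card s s⟩

end Summit.MatrixMultiplication.MatrixMultiplication.Theorems
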